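import Summits.NavierStokesRegularity.NavierStokesRegularity.Theorems.OddMorawetzLocal.Negative.OddMorawetzLocalRefutationDefsFast
import Summits.NavierStokesRegularity.NavierStokesRegularity.Theorems.OddMorawetzLocal.Negative.OddMorawetzLocalB3Reduction
import Summits.NavierStokesRegularity.NavierStokesRegularity.Theorems.OddMorawetzOddMorawetzLocalLinAnalysis
import Summits.NavierStokesRegularity.NavierStokesRegularity.Theorems.OddMorawetzOddMorawetzLocalNfSound
import Summits.NavierStokesRegularity.NavierStokesRegularity.Theorems.OddMorawetzOddMorawetzLocalNormCast
import Summits.NavierStokesRegularity.NavierStokesRegularity.Theorems.OddMorawetzOddMorawetzLocalNormFSemantics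
import Summits.NavierStokesRegularity.NavierStokesRegularity.Theorems.OddMorawetzOddMorawetzLocalPgvJetsIbp
import Summits.NavierStokesRegularity.NavierStokesRegularity.Theorems.OddMorawetzMorawetzKillsTypeIDivFreeEulerBilinear
import Mathlib.Analysis.Calculus.LineDeriv.IntegrationByParts
import HarnessLib

/-!
# Crux `OddMorawetzLocal` (stmt-NavierStokesRegularity-1376), refutation: the two null lemmas

Stub `null_lemmas` of the refutation skeleton of the crux `OddMorawetzLocal` (lead c1).  Mathlib plus landed tree
theorems (`lin_jetVal_sound`, `hasDerivAt_evalA_line`, `jetVal_add_smul`, `nf_sound`, `evalA_norm`, `cast_subst`,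
`cast_nfVar`, `cast_append`, `cast_D`, `JPoly.evalA_normF`, `JPoly.cast_normF`, `stub_jetDecay`,
`stub_divFree_eulerBilinear`, `schwartz_decay_four`, `StubFluxTransfer.integrable_inv_one_add_norm_pow`,
`norm_jetVal_le`); no definitions, no named facts.

For a divergence-free Schwartz field `v` on `ℝ³` with Euler nonlinearity `b = B(v,v) = eulerBilinear v v`, the
Morawetz pairing of a rational jet polynomial `q` is `∫ lin q (Jv)(Jb)`, the integral of the linearisation
`JPoly.lin` of `q` at the jets `jetVal v x` in the direction `jetVal b x`.  Two classes of polynomials pair to zero: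

* `integral_lin_divergence_eq_zero` — total divergences `div F = D₀F₀ + D₁F₁ + D₂F₂` of jet-polynomial fluxes of
  jet order `≤ 3`: the linearisation commutes with the total derivative (`lin_jetVal_sound`), so the integrand is
  `Σ_i ∂_i (lin Fᵢ (Jv)(Jb))`, and each `∫ ∂_i g = 0` because `g` and `∂_i g` are integrable (Mathlib's whole-space
  integration by parts `integral_mul_fderiv_eq_neg_fderiv_mul_of_integrable` against the constant `1`).
  Integrability (`NullLemmas.integrable_lin_jetVal`): the jets of `v` of order `≤ 4` are bounded and those of `b`
  are `O((1+|x|)⁻⁴)` (`schwartz_decay_four`, `stub_jetDecay`), so by the Leibniz shape of `prodDeriv` (exactly one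
  `b`-factor per summand) `|lin q (Jv)(Jb)| ≤ K (1+|x|)⁻⁴`, which is integrable on `ℝ³`.
* `lin_eq_zero_of_nfKills` — members of the divergence-free differential ideal, certified in the kernel by
  `isZeroF (subst nfVar q) = true`: polarise the soundness of the normal form (`nf_sound`) along the line of smooth
  divergence-free fields `v + s b` (`stub_divFree_eulerBilinear`); `s ↦ evalA q (J(v + s b))` vanishes identically
  and its derivative at `s = 0` is `lin q (Jv)(Jb)` (`hasDerivAt_evalA_line`, `jetVal_add_smul`).

The registered conjunction is `null_lemmas`.
-/

noncomputable section

open MeasureTheory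
open Literature.Analysis.FluidPDE

set_option linter.dupNamespace false
set_option autoImplicit false

namespace Summit.NavierStokesRegularity.NavierStokesRegularity.Theorems.OddMorawetz

namespace NullLemmas

/-! ### List combinatorics: jet orders under `cast`, `D i`; `lin` and `cast` on concatenations -/

/-- Sorted insertion lengthens an index list by one. -/
theorem length_insertIdx (i : Fin 3) : ∀ l : List (Fin 3), (insertIdx i l).length = l.length + 1
  -- adapted from OddMorawetzOddMorawetzLocalActSemantics (private there)
  | [] => rfl
  | j :: js => by
    simp only [insertIdx]
    split_ifs
    · simp [length_insertIdx i js]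
    · rfl

/-- The monomials of `derivVars i m` have jet orders at most one more than those of `m`. -/
theorem derivVars_order {n : ℕ} (i : Fin 3) : ∀ (m : List JVar), (∀ w ∈ m, w.2.length ≤ n) →
    ∀ l ∈ JPoly.derivVars i m, ∀ w ∈ l, w.2.length ≤ n + 1
  | [], _, l, hl, _, _ => by simp [JPoly.derivVars] at hl
  | u :: us, hm, l, hl, w, hw => by
    simp only [JPoly.derivVars, List.mem_cons, List.mem_map] at hl
    rcases hl with rfl | ⟨l', hl', rfl⟩
    · rcases List.mem_cons.1 hw with rfl | hw'
      · rw [length_insertIdx]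
        exact Nat.succ_le_succ (hm u (by simp))
      · exact (hm w (List.mem_cons_of_mem _ hw')).trans (Nat.le_succ n)
    · rcases List.mem_cons.1 hw with rfl | hw'
      · exact (hm w (by simp)).trans (Nat.le_succ n)
      · exact derivVars_order i us (fun w' hw'' => hm w' (List.mem_cons_of_mem _ hw'')) l' hl' w hw'

/-- The total derivative `D i` raises the jet orders of a polynomial by at most one. -/
theorem D_order {n : ℕ} (i : Fin 3) (p : JPoly ℝ) (hp : ∀ t ∈ p, ∀ w ∈ t.2, w.2.length ≤ n) :
    ∀ t ∈ JPoly.D i p, ∀ w ∈ t.2, w.2.length ≤ n + 1 := by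
  intro t ht w hw
  simp only [JPoly.D, List.mem_flatMap, List.mem_map] at ht
  obtain ⟨t', ht', l, hl, rfl⟩ := ht
  exact derivVars_order i t'.2 (hp t' ht') l hl w hw

/-- The coefficient cast does not change the monomials (hence the jet orders). -/
theorem cast_order {n : ℕ} (p : JPoly ℚ) (hp : ∀ t ∈ p, ∀ w ∈ t.2, w.2.length ≤ n) :
    ∀ t ∈ JPoly.cast p, ∀ w ∈ t.2, w.2.length ≤ n := by
  intro t ht w hw
  simp only [JPoly.cast, List.mem_map] at ht
  obtain ⟨t', ht', rfl⟩ := ht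
  exact hp t' ht' w hw

/-- `lin` is additive under concatenation of polynomials. -/
theorem lin_append (p q : JPoly ℝ) (ζ η : JVar → ℝ) :
    JPoly.lin (p ++ q) ζ η = JPoly.lin p ζ η + JPoly.lin q ζ η := by
  simp [JPoly.lin, List.sum_append]

/-- The cast of the divergence of a rational flux triple is the concatenation of the real total derivatives. -/
theorem cast_divergence (F₀ F₁ F₂ : JPoly ℚ) :
    JPoly.cast (JPoly.divergence (F₀, F₁, F₂)) =
      JPoly.D 0 (JPoly.cast F₀) ++ (JPoly.D 1 (JPoly.cast F₁) ++ JPoly.D 2 (JPoly.cast F₂)) := by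
  simp only [JPoly.divergence, cast_append, cast_D]

/-! ### Bounds for monomials, their Leibniz linearisation, and `lin` -/

/-- A product of factors bounded by `M ≥ 0` is bounded by `M ^ length`. -/
theorem abs_prod_map_le {M : ℝ} (hM : 0 ≤ M) (ζ : JVar → ℝ) :
    ∀ m : List JVar, (∀ w ∈ m, |ζ w| ≤ M) → |(m.map ζ).prod| ≤ M ^ m.length
  | [], _ => by simp
  | w :: ws, h => by
    rw [List.map_cons, List.prod_cons, abs_mul, List.length_cons, pow_succ']
    exact mul_le_mul (h w (by simp)) (abs_prod_map_le hM ζ ws fun w' hw' => h w' (List.mem_cons_of_mem _ hw'))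
      (abs_nonneg _) hM

/-- **Leibniz bound**: if `|ζ w| ≤ M` and `|η w| ≤ M ε` on the variables of `m`, then
`|prodDeriv m ζ η| ≤ |m| · M^{|m|} · ε` (each summand carries exactly one `η`-factor). -/
theorem abs_prodDeriv_le {M ε : ℝ} (hM : 0 ≤ M) (hε : 0 ≤ ε) (ζ η : JVar → ℝ) :
    ∀ m : List JVar, (∀ w ∈ m, |ζ w| ≤ M) → (∀ w ∈ m, |η w| ≤ M * ε) →
      |JPoly.prodDeriv m ζ η| ≤ m.length * M ^ m.length * ε
  | [], _, _ => by simp [JPoly.prodDeriv]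
  | w :: ws, hζ, hη => by
    have ih := abs_prodDeriv_le hM hε ζ η ws (fun w' hw' => hζ w' (List.mem_cons_of_mem _ hw'))
      (fun w' hw' => hη w' (List.mem_cons_of_mem _ hw'))
    have hp := abs_prod_map_le hM ζ ws (fun w' hw' => hζ w' (List.mem_cons_of_mem _ hw'))
    have h1 : |η w * (ws.map ζ).prod| ≤ M * ε * M ^ ws.length := by
      rw [abs_mul]
      exact mul_le_mul (hη w (by simp)) hp (abs_nonneg _) (mul_nonneg hM hε)
    have h2 : |ζ w * JPoly.prodDeriv ws ζ η| ≤ M * (ws.length * M ^ ws.length * ε) := by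
      rw [abs_mul]
      exact mul_le_mul (hζ w (by simp)) ih (abs_nonneg _) hM
    simp only [JPoly.prodDeriv, List.length_cons, Nat.cast_succ, pow_succ]
    calc |η w * (ws.map ζ).prod + ζ w * JPoly.prodDeriv ws ζ η|
        ≤ |η w * (ws.map ζ).prod| + |ζ w * JPoly.prodDeriv ws ζ η| := abs_add_le _ _
      _ ≤ M * ε * M ^ ws.length + M * (ws.length * M ^ ws.length * ε) := add_le_add h1 h2
      _ = (ws.length + 1) * (M ^ ws.length * M) * ε := by ring

/-- **Bound for the linearisation**: under the same variable bounds for all variables of jet order `≤ n`, a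
polynomial `p` of jet order `≤ n` has `|lin p ζ η| ≤ K(p, M) · ε`. -/
theorem abs_lin_le {M ε : ℝ} (hM : 0 ≤ M) (hε : 0 ≤ ε) (ζ η : JVar → ℝ) {n : ℕ}
    (hζ : ∀ w : JVar, w.2.length ≤ n → |ζ w| ≤ M) (hη : ∀ w : JVar, w.2.length ≤ n → |η w| ≤ M * ε) :
    ∀ p : JPoly ℝ, (∀ t ∈ p, ∀ w ∈ t.2, w.2.length ≤ n) →
      |JPoly.lin p ζ η| ≤ (p.map fun t => |t.1| * (t.2.length * M ^ t.2.length)).sum * ε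
  | [], _ => by simp [JPoly.lin]
  | t :: p, hp => by
    have ht := hp t (by simp)
    have ih := abs_lin_le hM hε ζ η hζ hη p (fun t' ht' => hp t' (List.mem_cons_of_mem _ ht'))
    have hd := abs_prodDeriv_le hM hε ζ η t.2 (fun w hw => hζ w (ht w hw)) (fun w hw => hη w (ht w hw))
    simp only [JPoly.lin, List.map_cons, List.sum_cons] at ih ⊢
    calc |t.1 * JPoly.prodDeriv t.2 ζ η + (p.map fun t => t.1 * JPoly.prodDeriv t.2 ζ η).sum|
        ≤ |t.1 * JPoly.prodDeriv t.2 ζ η| + |(p.map fun t => t.1 * JPoly.prodDeriv t.2 ζ η).sum| :=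
          abs_add_le _ _
      _ ≤ |t.1| * (t.2.length * M ^ t.2.length * ε) +
            (p.map fun t => |t.1| * (t.2.length * M ^ t.2.length)).sum * ε := by
          rw [abs_mul]
          exact add_le_add (mul_le_mul_of_nonneg_left hd (abs_nonneg _)) ih
      _ = _ := by ring

/-! ### The fields: jet bounds, integrability of the pairing integrand, vanishing integrals of derivatives -/

section Fields

variable {v : EuclideanSpace ℝ (Fin 3) → EuclideanSpace ℝ (Fin 3)}

/-- **Jet bounds**: for a divergence-free Schwartz field `v` there is `M ≥ 0` with `|∂^l v_a| ≤ M` and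
`|∂^l B(v,v)_a (y)| ≤ M (1+|y|)⁻⁴` for all `|l| ≤ 4` (`schwartz_decay_four`, `stub_jetDecay`, `norm_jetVal_le`). -/
theorem jet_bounds (hv : IsSchwartzField v) (hd : VectorCalculus.IsDivFree v) :
    ∃ M : ℝ, 0 ≤ M ∧ (∀ w : JVar, w.2.length ≤ 4 → ∀ y, |jetVal v y w| ≤ M) ∧
      (∀ w : JVar, w.2.length ≤ 4 → ∀ y,
        |jetVal (eulerBilinear v v) y w| ≤ M * ((1 + ‖y‖) ^ 4)⁻¹) := by
  obtain ⟨A, hA⟩ := schwartz_decay_four hv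
  obtain ⟨-, C, hC⟩ := stub_jetDecay v hv hd
  refine ⟨max (max A C) 0, le_max_right _ _, fun w hw y => ?_, fun w hw y => ?_⟩
  · have h1 : (1 : ℝ) ≤ (1 + ‖y‖) ^ 4 := one_le_pow₀ (by linarith [norm_nonneg y])
    calc |jetVal v y w| = ‖jetVal v y (w.1, w.2)‖ := rfl
      _ ≤ ‖iteratedFDeriv ℝ w.2.length v y‖ := norm_jetVal_le v y w.1 w.2
      _ ≤ (1 + ‖y‖) ^ 4 * ‖iteratedFDeriv ℝ w.2.length v y‖ := le_mul_of_one_le_left (norm_nonneg _) h1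
      _ ≤ A := hA _ hw y
      _ ≤ max (max A C) 0 := (le_max_left _ _).trans (le_max_left _ _)
  · have hpos : (0 : ℝ) < (1 + ‖y‖) ^ 4 := by positivity
    rw [← div_eq_mul_inv, le_div_iff₀ hpos]
    calc |jetVal (eulerBilinear v v) y w| * (1 + ‖y‖) ^ 4
        = (1 + ‖y‖) ^ 4 * ‖jetVal (eulerBilinear v v) y (w.1, w.2)‖ := by rw [mul_comm]; rfl
      _ ≤ (1 + ‖y‖) ^ 4 * ‖iteratedFDeriv ℝ w.2.length (eulerBilinear v v) y‖ :=
          mul_le_mul_of_nonneg_left (norm_jetVal_le _ y w.1 w.2) hpos.le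
      _ ≤ C := hC _ hw y
      _ ≤ max (max A C) 0 := (le_max_right _ _).trans (le_max_left _ _)

/-- **Integrability of the pairing integrand**: for a divergence-free Schwartz field `v` and a real jet
polynomial `q` of jet order `≤ 4`, `y ↦ lin q (jetVal v y) (jetVal B(v,v) y)` is integrable on `ℝ³`
(continuous by `lin_jetVal_sound`, dominated by `K (1+|y|)⁻⁴` by `abs_lin_le` and `jet_bounds`). -/
theorem integrable_lin_jetVal (hv : IsSchwartzField v) (hd : VectorCalculus.IsDivFree v) (q : JPoly ℝ)
    (hq : ∀ t ∈ q, ∀ w ∈ t.2, w.2.length ≤ 4) :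
    Integrable fun y => JPoly.lin q (jetVal v y) (jetVal (eulerBilinear v v) y) := by
  have hvs : ContDiff ℝ (⊤ : ℕ∞) v := ((isSchwartzField_iff v).1 hv).1
  obtain ⟨hb, -⟩ := stub_jetDecay v hv hd
  obtain ⟨M, hM, hV, hB⟩ := jet_bounds hv hd
  refine Integrable.mono'
    (StubFluxTransfer.integrable_inv_one_add_norm_pow.const_mul
      (q.map fun t => |t.1| * (t.2.length * M ^ t.2.length)).sum)
    (lin_jetVal_sound q v _ hvs hb).1.continuous.aestronglyMeasurable (ae_of_all _ fun y => ?_)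
  rw [Real.norm_eq_abs]
  exact abs_lin_le hM (by positivity) (jetVal v y) (jetVal (eulerBilinear v v) y) (n := 4)
    (fun w hw => hV w hw y) (fun w hw => hB w hw y) q hq

end Fields

/-- **Integrals of partial derivatives vanish**: if `g : ℝ³ → ℝ` is differentiable, integrable, and
`∂_i g = h` is integrable, then `∫ h = 0` (Mathlib's `integral_mul_fderiv_eq_neg_fderiv_mul_of_integrable` with the
constant factor `1`). -/
theorem integral_eq_zero_of_fderiv (i : Fin 3) {g h : EuclideanSpace ℝ (Fin 3) → ℝ} (hg : Differentiable ℝ g)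
    (hint : Integrable g) (hh : Integrable h) (hgh : ∀ x, fderiv ℝ g x (stdVec i) = h x) : ∫ x, h x = 0 := by
  have hibp := integral_mul_fderiv_eq_neg_fderiv_mul_of_integrable (μ := volume)
    (f := fun _ : EuclideanSpace ℝ (Fin 3) => (1 : ℝ)) (g := g) (v := stdVec i) ?_ ?_ ?_
    (fun x _ => differentiableAt_const _) (fun x _ => hg x)
  · simpa [hgh] using hibp
  · simp
  · simpa [hgh] using hh
  · simpa using hint

/-- **Divergence-free fields form a linear family**: `v + s • b` is divergence free for smooth divergence-free
`v`, `b` (the trace and the Fréchet derivative are linear). -/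
theorem isDivFree_add_smul {v b : EuclideanSpace ℝ (Fin 3) → EuclideanSpace ℝ (Fin 3)}
    (hv : ContDiff ℝ (⊤ : ℕ∞) v) (hb : ContDiff ℝ (⊤ : ℕ∞) b)
    (hvd : VectorCalculus.IsDivFree v) (hbd : VectorCalculus.IsDivFree b) (s : ℝ) :
    VectorCalculus.IsDivFree (v + s • b) := by
  intro x
  have h : HasFDerivAt (v + s • b) (fderiv ℝ v x + s • fderiv ℝ b x) x :=
    ((hv.differentiable (by simp)) x).hasFDerivAt.add (((hb.differentiable (by simp)) x).hasFDerivAt.const_smul s)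
  have hvx := hvd x
  have hbx := hbd x
  unfold VectorCalculus.divergence at hvx hbx ⊢
  rw [h.fderiv, ContinuousLinearMap.toLinearMap_add, ContinuousLinearMap.toLinearMap_smul, map_add, map_smul,
    hvx, hbx, smul_zero, add_zero]

end NullLemmas

/-! ### Part 1: divergences of jet-polynomial fluxes pair to zero -/

/-- **Null lemma 1 (divergences).** For a divergence-free Schwartz field `v` on `ℝ³` and rational jet-polynomial
fluxes `F₀, F₁, F₂` of jet order `≤ 3`, the Morawetz pairing of `div F = D₀F₀ + D₁F₁ + D₂F₂` vanishes:
`∫ lin (div F) (Jv) (J B(v,v)) = 0` — the linearisation of a divergence is the divergence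
`Σ_i ∂_i (lin Fᵢ (Jv)(J B(v,v)))` (`lin_jetVal_sound`), whose integral vanishes term by term since each
`lin Fᵢ (Jv)(J B(v,v))` and its derivative are integrable (`NullLemmas.integrable_lin_jetVal`). -/
theorem integral_lin_divergence_eq_zero (v : EuclideanSpace ℝ (Fin 3) → EuclideanSpace ℝ (Fin 3))
    (hv : Literature.Analysis.FluidPDE.IsSchwartzField v) (hd : Literature.Analysis.FluidPDE.VectorCalculus.IsDivFree v)
    (F₀ F₁ F₂ : JPoly ℚ) (hF : ∀ F ∈ [F₀, F₁, F₂], ∀ t ∈ F, ∀ u ∈ t.2, u.2.length ≤ 3) :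
    ∫ x, JPoly.lin (JPoly.cast (JPoly.divergence (F₀, F₁, F₂))) (jetVal v x)
        (jetVal (Literature.Analysis.FluidPDE.eulerBilinear v v) x) = 0 := by
  have hvs : ContDiff ℝ (⊤ : ℕ∞) v := ((isSchwartzField_iff v).1 hv).1
  obtain ⟨hb, -⟩ := stub_jetDecay v hv hd
  -- each `lin (D i Fᵢ)` is integrable with vanishing integral
  have key : ∀ (i : Fin 3) (F : JPoly ℚ), (∀ t ∈ F, ∀ u ∈ t.2, u.2.length ≤ 3) →
      Integrable (fun y => JPoly.lin (JPoly.D i (JPoly.cast F)) (jetVal v y) (jetVal (eulerBilinear v v) y)) ∧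
      ∫ y, JPoly.lin (JPoly.D i (JPoly.cast F)) (jetVal v y) (jetVal (eulerBilinear v v) y) = 0 := by
    intro i F hF3
    have h3 : ∀ t ∈ JPoly.cast F, ∀ w ∈ t.2, w.2.length ≤ 3 := NullLemmas.cast_order F hF3
    have h4 : ∀ t ∈ JPoly.cast F, ∀ w ∈ t.2, w.2.length ≤ 4 := fun t ht w hw => (h3 t ht w hw).trans (by norm_num)
    have hD4 : ∀ t ∈ JPoly.D i (JPoly.cast F), ∀ w ∈ t.2, w.2.length ≤ 4 := NullLemmas.D_order i _ h3
    obtain ⟨hsm, hder⟩ := lin_jetVal_sound (JPoly.cast F) v (eulerBilinear v v) hvs hb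
    have hintD := NullLemmas.integrable_lin_jetVal hv hd _ hD4
    exact ⟨hintD, NullLemmas.integral_eq_zero_of_fderiv i (hsm.differentiable (by simp))
      (NullLemmas.integrable_lin_jetVal hv hd _ h4) hintD (hder i)⟩
  obtain ⟨hi0, he0⟩ := key 0 F₀ (hF F₀ (by simp))
  obtain ⟨hi1, he1⟩ := key 1 F₁ (hF F₁ (by simp))
  obtain ⟨hi2, he2⟩ := key 2 F₂ (hF F₂ (by simp))
  simp_rw [NullLemmas.cast_divergence, NullLemmas.lin_append]
  rw [integral_add hi0 (hi1.fun_add hi2), integral_add hi1 hi2, he0, he1, he2, add_zero, add_zero]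

/-! ### Part 2: the divergence-free ideal pairs to zero pointwise -/

/-- **Null lemma 2 (the divergence-free ideal).** If the kernel certifies `isZeroF (subst nfVar q) = true` (the
divergence-free normal form of `q` is the zero polynomial), then for a divergence-free Schwartz field `v` the
integrand `lin q (Jv x) (J B(v,v) x)` vanishes at every point: along the smooth divergence-free line `v + s B(v,v)`
(`stub_divFree_eulerBilinear`) the value `evalA q (J(v + s B(v,v)) x)` is identically zero by `nf_sound`, and its
`s`-derivative at `0` is `lin q (Jv x)(J B(v,v) x)` (`hasDerivAt_evalA_line`, `jetVal_add_smul`). -/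
theorem lin_eq_zero_of_nfKills (v : EuclideanSpace ℝ (Fin 3) → EuclideanSpace ℝ (Fin 3))
    (hv : Literature.Analysis.FluidPDE.IsSchwartzField v) (hd : Literature.Analysis.FluidPDE.VectorCalculus.IsDivFree v)
    (q : JPoly ℚ) (hq : JPoly.isZeroF (JPoly.subst JPoly.nfVar q) = true) (x : EuclideanSpace ℝ (Fin 3)) :
    JPoly.lin (JPoly.cast q) (jetVal v x) (jetVal (Literature.Analysis.FluidPDE.eulerBilinear v v) x) = 0 := by
  have hvs : ContDiff ℝ (⊤ : ℕ∞) v := ((isSchwartzField_iff v).1 hv).1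
  obtain ⟨hb, -⟩ := stub_jetDecay v hv hd
  have hbd : VectorCalculus.IsDivFree (eulerBilinear v v) := stub_divFree_eulerBilinear v hv hd
  have hnil : JPoly.normF (JPoly.subst JPoly.nfVar q) = [] := List.isEmpty_iff.1 hq
  -- `q` vanishes on the jets of every smooth divergence-free field
  have hzero : ∀ u : EuclideanSpace ℝ (Fin 3) → EuclideanSpace ℝ (Fin 3), ContDiff ℝ (⊤ : ℕ∞) u →
      VectorCalculus.IsDivFree u → ∀ y, JPoly.evalA (JPoly.cast q) (jetVal u y) = 0 := by
    intro u hu hud y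
    rw [← nf_sound u hu hud, JPoly.nf, evalA_norm, ← cast_subst JPoly.nfVar JPoly.nfVar cast_nfVar,
      ← JPoly.evalA_normF, ← JPoly.cast_normF, hnil]
    simp [JPoly.evalA]
  -- polarise along the line `v + s • b`
  have hline : (fun s : ℝ => JPoly.evalA (JPoly.cast q) (jetVal v x + s • jetVal (eulerBilinear v v) x)) =
      fun _ => 0 := by
    funext s
    rw [← jetVal_add_smul v (eulerBilinear v v) hvs hb s x]
    exact hzero (v + s • eulerBilinear v v) (hvs.add (hb.const_smul s))
      (NullLemmas.isDivFree_add_smul hvs hb hd hbd s) x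
  have hderiv := hasDerivAt_evalA_line (JPoly.cast q) (jetVal v x) (jetVal (eulerBilinear v v) x)
  rw [hline] at hderiv
  exact hderiv.unique (hasDerivAt_const (0 : ℝ) (0 : ℝ))

/-! ### The registered stub -/

/-- **Stub `null_lemmas` of crux `OddMorawetzLocal`** (refutation skeleton).  For a divergence-free Schwartz
field `v` on `ℝ³` with Euler nonlinearity `B(v,v)`: (1) the Morawetz pairing `∫ lin (div F) (Jv) (J B(v,v))` of
the divergence of any rational jet-polynomial flux triple of jet order `≤ 3` vanishes; (2) every rational jet
polynomial in the divergence-free differential ideal (kernel certificate `isZeroF (subst nfVar q)`) has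
identically vanishing pairing integrand `lin q (Jv x) (J B(v,v) x) = 0`. -/
theorem null_lemmas (v : EuclideanSpace ℝ (Fin 3) → EuclideanSpace ℝ (Fin 3))
    (hv : Literature.Analysis.FluidPDE.IsSchwartzField v) (hd : Literature.Analysis.FluidPDE.VectorCalculus.IsDivFree v) :
    (∀ (F₀ F₁ F₂ : JPoly ℚ), (∀ F ∈ [F₀, F₁, F₂], ∀ t ∈ F, ∀ u ∈ t.2, u.2.length ≤ 3) →
      ∫ x, JPoly.lin (JPoly.cast (JPoly.divergence (F₀, F₁, F₂))) (jetVal v x)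
          (jetVal (Literature.Analysis.FluidPDE.eulerBilinear v v) x) = 0) ∧
    (∀ (q : JPoly ℚ), JPoly.isZeroF (JPoly.subst JPoly.nfVar q) = true → ∀ x,
      JPoly.lin (JPoly.cast q) (jetVal v x) (jetVal (Literature.Analysis.FluidPDE.eulerBilinear v v) x) = 0) :=
  ⟨fun F₀ F₁ F₂ hF => integral_lin_divergence_eq_zero v hv hd F₀ F₁ F₂ hF,
    fun q hq x => lin_eq_zero_of_nfKills v hv hd q hq x⟩

end Summit.NavierStokesRegularity.NavierStokesRegularity.Theorems.OddMorawetz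

end
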